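import Literature.Analysis.Complex.TwoDirectionTaylor
import Mathlib.LinearAlgebra.Vandermonde
import Mathlib.LinearAlgebra.Matrix.NonsingularInverse
import Mathlib.Analysis.Normed.Group.Tannery
import Mathlib.Analysis.Complex.Basic
import HarnessLib

/-!
# Positive-semidefinite kernels and the propagation of positivity under analytic continuation

Analysis/Complex support file. Two things:

* the elementary notion of a **positive-semidefinite kernel on a subset**,
  `IsPosSemidefKernelOn K A`: `∑ᵢⱼ c̄ᵢ cⱼ K(xᵢ, xⱼ) ≥ 0` for all finite families of points of `A`
  (E. H. Moore 1916 / Aronszajn 1950; witness form with `Fin m`-indexed families, so that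
  pull-backs are trivial), with its basic API (`mono`, `comp`, finite index types, stability
  under pointwise limits);
* **Glaser's lemma on the analytic continuation of positivity** (V. Glaser, *On the equivalence
  of the Euclidean and Wightman formulation of field theory*, Comm. Math. Phys. 37 (1974)
  257–272, the step "positive-definiteness of the Schwinger functions at Euclidean points
  propagates to the whole domain of holomorphy of their analytic continuation"), in the
  one-complex-variable form with parameters from which the several-variable statement follows
  by induction on the number of variables (`isPosSemidefKernelOn_halfPlane_of_ofReal`): let
  `K` be a kernel on `X × ℂ` which on the right half-plane `Π = {Re s > 0}` is sesqui-holomorphic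
  in the complex coordinate, `K((u, s), (u', s')) = k_{u u'}(s̄, s')` with every `k_{u u'}`
  admitting bounded double Taylor expansions on bidiscs in `Π × Π` (`HasLocalTaylor₂`, e.g. any
  jointly holomorphic function, `hasLocalTaylor₂_comp_affine`); if `K` is positive-semidefinite
  on `X × (0, ∞)` then it is positive-semidefinite on `X × Π`.

## Proof of Glaser's lemma (power series at real centres; no Hilbert space is built)

Given points `(u_a, δ_a)`, `Re δ_a > 0`, put `σ_a = |δ_a|² / Re δ_a > 0`, so that
`|δ_a - σ_a| < σ_a` and `δ̄_a, δ_a` lie in a disc `B(σ_a, ρ_a)`, `ρ_a < σ_a`, inside `Π`. Expanding,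
`K_{ab} = ∑_{j,l} J^{ab}_{jl} conj((δ_a - σ_a)^j) (δ_b - σ_b)^l` (absolutely), so the quadratic
form is the limit `N → ∞` of the *jet forms* `∑_{j,l ≤ N} ∑_{ab} J^{ab}_{jl} conj(v_{aj}) v_{bl}`,
`v_{aj} = c_a (δ_a - σ_a)^j`. **Jet positivity**: for any `(v_{aj})_{j ≤ N}`, choose `N + 1`
distinct nodes `ξ_i ∈ (0, κ]`, `κ = min ρ / 2`, and for `0 < ε ≤ 1` coefficients `γ^ε_{a i}`
(Vandermonde) with moments `∑_i γ^ε_{ai} (ε ξ_i)^j = v_{aj}` for `j ≤ N`; the higher moments are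
`O(ε^{j-N} κ^j)`. Positivity of `K` on the real points `(u_a, σ_a + ε ξ_i)` and the real Taylor
expansion give `0 ≤ ∑_{j,l} ∑_{ab} J^{ab}_{jl} conj(μ^ε_{aj}) μ^ε_{bl}`, and `ε → 0` under Tannery's
theorem (domination by `(κ/ρ)^{j+l} ≤ 2^{-j-l}`) yields the jet form. No Hermitian symmetry of
`K` is needed.

## References

* V. Glaser, Comm. Math. Phys. 37 (1974) 257–272. [GlaserCMP1974]
* N. Aronszajn, *Theory of reproducing kernels*, Trans. AMS 68 (1950) (positive matrices /
  kernels; the notion is folklore).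

## Mathlib

Used: `Matrix.vandermonde`, `Matrix.det_vandermonde_ne_zero_iff`, `Matrix.nonsing_inv_mul`,
`tendsto_tsum_of_dominated_convergence` (Tannery), the scoped `ComplexOrder` and its
`OrderClosedTopology`. Mathlib has positive-semidefinite *matrices* (`Matrix.PosSemidef`) but no
kernels on sets and nothing on analytic continuation of positivity (searched `PosSemidef`,
`positive definite kernel`, `reproducing`).
-/

noncomputable section

open Metric Set Filter Finset
open scoped Topology ComplexOrder ComplexConjugate BigOperators

namespace Literature.Analysis.Complex

/-! ### Positive-semidefinite kernels on a subset -/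

section Kernel

variable {α β : Type*}

/-- A kernel `K : α → α → ℂ` is **positive-semidefinite on the subset `A`** if for every finite
family of points `x₀, …, x_{m-1} ∈ A` (repetitions allowed) and coefficients `c₀, …, c_{m-1} ∈ ℂ`,
`∑ᵢ ∑ⱼ conj (cᵢ) cⱼ K (xᵢ, xⱼ) ≥ 0` in the order of `ℂ` (`0 ≤ z ↔ 0 ≤ Re z ∧ Im z = 0`), i.e. all
the matrices `(K (xᵢ, xⱼ))ᵢⱼ` are positive-semidefinite (E. H. Moore; Aronszajn (1950) §2,
"positive matrix"). Hermitian symmetry is not part of the definition (it follows, as usual,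
but is never needed here). [folklore] -/
def IsPosSemidefKernelOn (K : α → α → ℂ) (A : Set α) : Prop :=
  ∀ (m : ℕ) (x : Fin m → α), (∀ i, x i ∈ A) → ∀ c : Fin m → ℂ,
    0 ≤ ∑ i, ∑ j, conj (c i) * c j * K (x i) (x j)

namespace IsPosSemidefKernelOn

variable {K : α → α → ℂ} {A : Set α}

/-- Positive-semidefiniteness is inherited by subsets. [folklore] -/
theorem mono {A' : Set α} (h : IsPosSemidefKernelOn K A) (hA : A' ⊆ A) :
    IsPosSemidefKernelOn K A' :=
  fun m x hx c => h m x (fun i => hA (hx i)) c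

/-- Pull-back: if `f` maps `B` into `A`, the kernel `K (f ·, f ·)` is positive-semidefinite on
`B`. [folklore] -/
theorem comp (h : IsPosSemidefKernelOn K A) {B : Set β} (f : β → α) (hf : MapsTo f B A) :
    IsPosSemidefKernelOn (fun x y => K (f x) (f y)) B :=
  fun m x hx c => h m (f ∘ x) (fun i => hf (hx i)) c

/-- The defining inequality for families indexed by an arbitrary finite type. [folklore] -/
theorem sum_nonneg {ι : Type*} [Fintype ι] (h : IsPosSemidefKernelOn K A) (x : ι → α)
    (hx : ∀ i, x i ∈ A) (c : ι → ℂ) :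
    0 ≤ ∑ i, ∑ j, conj (c i) * c j * K (x i) (x j) := by
  classical
  set e := (Fintype.equivFin ι).symm with he
  have h' := h (Fintype.card ι) (x ∘ e) (fun i => hx _) (c ∘ e)
  simp only [Function.comp_apply] at h'
  have h1 : ∑ i, ∑ j, conj (c (e i)) * c (e j) * K (x (e i)) (x (e j)) =
      ∑ i, ∑ j, conj (c i) * c j * K (x i) (x j) := by
    rw [e.sum_comp (fun i => ∑ j, conj (c i) * c (e j) * K (x i) (x (e j)))]
    refine Finset.sum_congr rfl fun i _ => ?_
    exact e.sum_comp (fun j => conj (c i) * c j * K (x i) (x j))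
  rwa [h1] at h'

/-- A pointwise limit (on `A × A`) of kernels positive-semidefinite on `A` is positive-semidefinite
on `A`. [folklore] -/
theorem of_forall_tendsto {ι : Type*} {l : Filter ι} [l.NeBot] {Kn : ι → α → α → ℂ}
    (hKn : ∀ n, IsPosSemidefKernelOn (Kn n) A)
    (hlim : ∀ x ∈ A, ∀ y ∈ A, Tendsto (fun n => Kn n x y) l (𝓝 (K x y))) :
    IsPosSemidefKernelOn K A := by
  intro m x hx c
  have ht : Tendsto (fun n => ∑ i, ∑ j, conj (c i) * c j * Kn n (x i) (x j)) l
      (𝓝 (∑ i, ∑ j, conj (c i) * c j * K (x i) (x j))) :=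
    tendsto_finsetSum _ fun i _ => tendsto_finsetSum _ fun j _ =>
      (hlim _ (hx i) _ (hx j)).const_mul _
  exact ge_of_tendsto' ht fun n => hKn n m x hx c

/-- Diagonal values of a positive-semidefinite kernel are nonnegative. [folklore] -/
theorem apply_self_nonneg (h : IsPosSemidefKernelOn K A) {x : α} (hx : x ∈ A) : 0 ≤ K x x := by
  have := h 1 (fun _ => x) (fun _ => hx) (fun _ => 1)
  simpa using this

end IsPosSemidefKernelOn

end Kernel

/-! ### Vandermonde moments -/

section Moments

/-- **Prescribed low moments with small nodes** (Vandermonde): given distinct real nodes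
`ξ₀, …, ξ_N`, a target vector `w` and a scale `0 < ε ≤ 1`, there are complex weights `γᵢ` whose
moments against the scaled nodes `ε ξᵢ` are `∑ᵢ γᵢ (ε ξᵢ)ʲ = wⱼ` for all `j ≤ N`, with
`∑ᵢ |γᵢ| ≤ ε⁻ᴺ C` for a constant `C = C(ξ, w)` independent of `ε`. [folklore] -/
theorem exists_weights_moments_eq {N : ℕ} {ξ : Fin (N + 1) → ℝ} (hξ : Function.Injective ξ)
    (w : Fin (N + 1) → ℂ) :
    ∃ C : ℝ, 0 ≤ C ∧ ∀ ε : ℝ, 0 < ε → ε ≤ 1 →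
      ∃ γ : Fin (N + 1) → ℂ, (∀ j : Fin (N + 1), ∑ i, γ i * ((ε * ξ i : ℝ) : ℂ) ^ (j : ℕ) = w j) ∧
        ∑ i, ‖γ i‖ ≤ (ε ^ N)⁻¹ * C := by
  classical
  set V : Matrix (Fin (N + 1)) (Fin (N + 1)) ℂ := Matrix.vandermonde fun i => ((ξ i : ℝ) : ℂ) with hV
  have hdet : IsUnit V.det := by
    rw [isUnit_iff_ne_zero, hV, Matrix.det_vandermonde_ne_zero_iff]
    exact Complex.ofReal_injective.comp hξ
  refine ⟨∑ i, ∑ j, ‖w j‖ * ‖V⁻¹ j i‖, Finset.sum_nonneg fun i _ => Finset.sum_nonneg fun j _ =>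
    by positivity, fun ε hε hε1 => ?_⟩
  -- targets `r j = ε^{-j} w j`, weights `γ = r ᵥ* V⁻¹`
  set r : Fin (N + 1) → ℂ := fun j => (((ε : ℝ) : ℂ) ^ (j : ℕ))⁻¹ * w j with hr
  refine ⟨Matrix.vecMul r V⁻¹, fun j => ?_, ?_⟩
  · have hsolve : Matrix.vecMul (Matrix.vecMul r V⁻¹) V = r := by
      rw [Matrix.vecMul_vecMul, Matrix.nonsing_inv_mul _ hdet, Matrix.vecMul_one]
    -- `∑ i, γ i * ξ i ^ j = r j`; scale by `ε ^ j`
    have hVij : ∀ i, V i j = ((ξ i : ℝ) : ℂ) ^ (j : ℕ) := fun i => by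
      rw [hV, Matrix.vandermonde_apply]
    have hj : ∑ i, Matrix.vecMul r V⁻¹ i * V i j = r j := congrFun hsolve j
    have hε0 : ((ε : ℝ) : ℂ) ≠ 0 := Complex.ofReal_ne_zero.2 hε.ne'
    calc ∑ i, (Matrix.vecMul r V⁻¹) i * ((ε * ξ i : ℝ) : ℂ) ^ (j : ℕ)
        = ((ε : ℝ) : ℂ) ^ (j : ℕ) * ∑ i, (Matrix.vecMul r V⁻¹) i * V i j := by
          rw [Finset.mul_sum]
          refine Finset.sum_congr rfl fun i _ => ?_
          rw [hVij]
          push_cast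
          ring
      _ = ((ε : ℝ) : ℂ) ^ (j : ℕ) * r j := by rw [hj]
      _ = w j := by rw [hr]; field_simp
  · -- the `ℓ¹` bound on the weights
    have hεj : ∀ j : Fin (N + 1), ‖(((ε : ℝ) : ℂ) ^ (j : ℕ))⁻¹‖ ≤ (ε ^ N)⁻¹ := by
      intro j
      rw [norm_inv, norm_pow, Complex.norm_real, Real.norm_of_nonneg hε.le]
      exact inv_anti₀ (pow_pos hε _) (pow_le_pow_of_le_one hε.le hε1 (Nat.lt_succ_iff.1 j.2))
    calc ∑ i, ‖(Matrix.vecMul r V⁻¹) i‖ = ∑ i, ‖∑ j, r j * V⁻¹ j i‖ := by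
          simp [Matrix.vecMul, dotProduct]
      _ ≤ ∑ i, ∑ j, (ε ^ N)⁻¹ * (‖w j‖ * ‖V⁻¹ j i‖) := by
          refine Finset.sum_le_sum fun i _ => (norm_sum_le _ _).trans (Finset.sum_le_sum fun j _ => ?_)
          rw [norm_mul, hr, norm_mul, mul_assoc]
          exact mul_le_mul_of_nonneg_right (hεj j) (by positivity)
      _ = (ε ^ N)⁻¹ * ∑ i, ∑ j, ‖w j‖ * ‖V⁻¹ j i‖ := by
          rw [Finset.mul_sum]
          refine Finset.sum_congr rfl fun i _ => ?_
          rw [Finset.mul_sum]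

/-- Moments against nodes of size at most `κ` are bounded by `‖γ‖₁ κʲ`. [folklore] -/
theorem norm_sum_mul_pow_le {n : ℕ} (γ : Fin n → ℂ) {η : Fin n → ℝ} {κ : ℝ}
    (hη : ∀ i, |η i| ≤ κ) (j : ℕ) :
    ‖∑ i, γ i * ((η i : ℝ) : ℂ) ^ j‖ ≤ (∑ i, ‖γ i‖) * κ ^ j := by
  rw [Finset.sum_mul]
  refine (norm_sum_le _ _).trans (Finset.sum_le_sum fun i _ => ?_)
  rw [norm_mul, norm_pow, Complex.norm_real, Real.norm_eq_abs]
  exact mul_le_mul_of_nonneg_left (pow_le_pow_left₀ (abs_nonneg _) (hη i) j) (norm_nonneg _)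

end Moments

/-! ### Jet positivity -/

section Jet

variable {m N : ℕ}

/-- **Jet positivity from positivity at real points** (the combinatorial core of Glaser's lemma).
Let `J^{ab}_{jl}` (`a, b < m`, `(j, l) ∈ ℕ²`) be coefficients with the Cauchy bounds
`|J^{ab}_{jl}| ≤ M_{ab} ρ_a^{-j} ρ_b^{-l}`, let `0 < ξ₀, …, ξ_N ≤ κ` be distinct nodes with
`2κ ≤ ρ_a`, and suppose that for every `0 < ε ≤ 1` and all weights `Γ_{a i}` the "real" quadratic
form `∑_{jl} ∑_{ab} J^{ab}_{jl} conj(μ_{aj}) μ_{bl}` in the moments `μ_{aj} = ∑ᵢ Γ_{ai} (ε ξᵢ)ʲ` is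
nonnegative. Then the jet forms `∑_{j,l ≤ N} ∑_{ab} J^{ab}_{jl} conj(w_{aj}) w_{bl}` are
nonnegative for arbitrary `w`: realise `w_{aj}`, `j ≤ N`, as the low moments of suitable weights
(`exists_weights_moments_eq`), bound the high moments by `ε^{j-N} C κʲ`, and let `ε → 0` under
Tannery's theorem. [cite: GlaserCMP1974, §2 (positivity condition in the causal domain)] -/
theorem jetForm_nonneg (J : Fin m → Fin m → ℕ × ℕ → ℂ) (M : Fin m → Fin m → ℝ) (ρ : Fin m → ℝ)
    {κ : ℝ} (hκ : 0 < κ) (hκρ : ∀ a, 2 * κ ≤ ρ a)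
    (hJ : ∀ a b p, ‖J a b p‖ ≤ M a b / (ρ a ^ p.1 * ρ b ^ p.2))
    {ξ : Fin (N + 1) → ℝ} (hξ : Function.Injective ξ) (hξκ : ∀ i, 0 < ξ i ∧ ξ i ≤ κ)
    (hreal : ∀ ε : ℝ, 0 < ε → ε ≤ 1 → ∀ Γ : Fin m → Fin (N + 1) → ℂ,
      0 ≤ ∑' p : ℕ × ℕ, ∑ a, ∑ b, J a b p *
        (conj (∑ i, Γ a i * ((ε * ξ i : ℝ) : ℂ) ^ p.1) * ∑ i, Γ b i * ((ε * ξ i : ℝ) : ℂ) ^ p.2))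
    (w : Fin m → ℕ → ℂ) :
    0 ≤ ∑ p ∈ range (N + 1) ×ˢ range (N + 1), ∑ a, ∑ b, J a b p * (conj (w a p.1) * w b p.2) := by
  -- weights with prescribed low moments, for every `a` and every scale
  have hw := fun a => exists_weights_moments_eq hξ (fun j : Fin (N + 1) => w a (j : ℕ))
  choose C hC0 hCε using hw
  -- scales `ε_n = 1 / (n + 1)`
  set ε : ℕ → ℝ := fun n => 1 / ((n : ℝ) + 1) with hε_def
  have hε : ∀ n, 0 < ε n ∧ ε n ≤ 1 := fun n => by
    refine ⟨by positivity, ?_⟩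
    rw [hε_def, div_le_one (by positivity)]
    linarith [n.cast_nonneg (α := ℝ)]
  have hεlim : Tendsto ε atTop (𝓝 0) := tendsto_one_div_add_atTop_nhds_zero_nat
  choose γ hγmom hγnorm using fun n a => hCε a (ε n) (hε n).1 (hε n).2
  -- moments
  set μ : ℕ → Fin m → ℕ → ℂ := fun n a j => ∑ i, γ n a i * ((ε n * ξ i : ℝ) : ℂ) ^ j with hμ_def
  set μ₀ : Fin m → ℕ → ℂ := fun a j => if j ≤ N then w a j else 0 with hμ₀_def
  have hμ_low : ∀ n a j, j ≤ N → μ n a j = w a j := fun n a j hj => by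
    have := hγmom n a ⟨j, Nat.lt_succ_of_le hj⟩
    simpa only [hμ_def] using this
  have hμ_bound : ∀ n a j, ‖μ n a j‖ ≤ ((ε n) ^ N)⁻¹ * C a * (ε n * κ) ^ j := by
    intro n a j
    have h1 := norm_sum_mul_pow_le (γ n a) (η := fun i => ε n * ξ i) (κ := ε n * κ)
      (fun i => by
        rw [abs_of_pos (mul_pos (hε n).1 (hξκ i).1)]
        exact mul_le_mul_of_nonneg_left (hξκ i).2 (hε n).1.le) j
    exact h1.trans (mul_le_mul_of_nonneg_right (hγnorm n a) (by
      have := (hε n).1; positivity))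
  have hμ_high : ∀ n a j, N < j → ‖μ n a j‖ ≤ ε n * (C a * κ ^ j) := by
    intro n a j hj
    refine (hμ_bound n a j).trans ?_
    obtain ⟨d, rfl⟩ := Nat.exists_eq_add_of_lt hj
    have hε0 := (hε n).1
    have hε1 := (hε n).2
    rw [mul_pow, show N + d + 1 = N + (d + 1) by ring, pow_add (ε n) N (d + 1)]
    have hd : (ε n) ^ (d + 1) ≤ ε n := by
      rw [pow_succ]
      calc (ε n) ^ d * ε n ≤ 1 * ε n :=
            mul_le_mul_of_nonneg_right (pow_le_one₀ hε0.le hε1) hε0.le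
        _ = ε n := one_mul _
    calc ((ε n) ^ N)⁻¹ * C a * ((ε n) ^ N * (ε n) ^ (d + 1) * κ ^ (N + (d + 1)))
        = (ε n) ^ (d + 1) * (C a * κ ^ (N + (d + 1))) := by
          field_simp
      _ ≤ ε n * (C a * κ ^ (N + (d + 1))) :=
          mul_le_mul_of_nonneg_right hd (by have := hC0 a; positivity)
  -- a uniform geometric bound `‖μ n a j‖ ≤ B κ^j`
  set B : ℝ := ∑ a, C a + ∑ a, ∑ j ∈ range (N + 1), ‖w a j‖ / κ ^ j with hB_def
  have hB0 : 0 ≤ B := by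
    have h1 : 0 ≤ ∑ a, C a := Finset.sum_nonneg fun a _ => hC0 a
    have h2 : 0 ≤ ∑ a, ∑ j ∈ range (N + 1), ‖w a j‖ / κ ^ j :=
      Finset.sum_nonneg fun a _ => Finset.sum_nonneg fun j _ => by positivity
    linarith
  have hCB : ∀ a, C a ≤ B := fun a => by
    have h1 : C a ≤ ∑ a, C a := Finset.single_le_sum (fun a _ => hC0 a) (mem_univ a)
    have h2 : 0 ≤ ∑ a, ∑ j ∈ range (N + 1), ‖w a j‖ / κ ^ j :=
      Finset.sum_nonneg fun a _ => Finset.sum_nonneg fun j _ => by positivity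
    linarith
  have hwB : ∀ a j, j ≤ N → ‖w a j‖ ≤ B * κ ^ j := fun a j hj => by
    have h1 : ‖w a j‖ / κ ^ j ≤ ∑ j ∈ range (N + 1), ‖w a j‖ / κ ^ j :=
      Finset.single_le_sum (f := fun j => ‖w a j‖ / κ ^ j) (fun j _ => by positivity)
        (mem_range.2 (Nat.lt_succ_of_le hj))
    have h2 : ∑ j ∈ range (N + 1), ‖w a j‖ / κ ^ j ≤ ∑ a, ∑ j ∈ range (N + 1), ‖w a j‖ / κ ^ j :=
      Finset.single_le_sum (f := fun a => ∑ j ∈ range (N + 1), ‖w a j‖ / κ ^ j)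
        (fun a _ => Finset.sum_nonneg fun j _ => by positivity) (mem_univ a)
    have h3 : 0 ≤ ∑ a, C a := Finset.sum_nonneg fun a _ => hC0 a
    have h4 : ‖w a j‖ / κ ^ j ≤ B := by linarith
    rwa [div_le_iff₀ (pow_pos hκ j)] at h4
  have hμB : ∀ n a j, ‖μ n a j‖ ≤ B * κ ^ j := by
    intro n a j
    rcases le_or_gt j N with hj | hj
    · rw [hμ_low n a j hj]; exact hwB a j hj
    · calc ‖μ n a j‖ ≤ ε n * (C a * κ ^ j) := hμ_high n a j hj
        _ ≤ 1 * (B * κ ^ j) := mul_le_mul (hε n).2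
            (mul_le_mul_of_nonneg_right (hCB a) (by positivity)) (by have := hC0 a; positivity)
            zero_le_one
        _ = B * κ ^ j := one_mul _
  have hμ₀B : ∀ a j, ‖μ₀ a j‖ ≤ B * κ ^ j := by
    intro a j
    simp only [hμ₀_def]
    split_ifs with hj
    · exact hwB a j hj
    · rw [norm_zero]; positivity
  -- pointwise convergence of the moments
  have hμlim : ∀ a j, Tendsto (fun n => μ n a j) atTop (𝓝 (μ₀ a j)) := by
    intro a j
    simp only [hμ₀_def]
    split_ifs with hj
    · exact tendsto_const_nhds.congr fun n => (hμ_low n a j hj).symm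
    · refine squeeze_zero_norm (fun n => hμ_high n a j (lt_of_not_ge hj)) ?_
      simpa using hεlim.mul_const (C a * κ ^ j)
  -- the families, the limit family and the dominating family
  set f : ℕ → ℕ × ℕ → ℂ := fun n p => ∑ a, ∑ b, J a b p * (conj (μ n a p.1) * μ n b p.2) with hf_def
  set g : ℕ × ℕ → ℂ := fun p => ∑ a, ∑ b, J a b p * (conj (μ₀ a p.1) * μ₀ b p.2) with hg_def
  set bound : ℕ × ℕ → ℝ := fun p => (∑ a, ∑ b, M a b) * B ^ 2 *
    ((1 / 2 : ℝ) ^ p.1 * (1 / 2 : ℝ) ^ p.2) with hbound_def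
  have hM0 : ∀ a b, 0 ≤ M a b := fun a b => by
    have := hJ a b (0, 0)
    simp only [pow_zero, mul_one, div_one] at this
    exact (norm_nonneg _).trans this
  have hρ0 : ∀ a, 0 < ρ a := fun a => by linarith [hκρ a]
  have hκρ' : ∀ a j, κ ^ j / ρ a ^ j ≤ (1 / 2 : ℝ) ^ j := fun a j => by
    rw [← div_pow]
    exact pow_le_pow_left₀ (div_nonneg hκ.le (hρ0 a).le) (by
      rw [div_le_iff₀ (hρ0 a)]; linarith [hκρ a]) j
  -- the key termwise estimate
  have hterm : ∀ (ν : Fin m → ℕ → ℂ), (∀ a j, ‖ν a j‖ ≤ B * κ ^ j) → ∀ p : ℕ × ℕ,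
      ‖∑ a, ∑ b, J a b p * (conj (ν a p.1) * ν b p.2)‖ ≤ bound p := by
    intro ν hν p
    refine (norm_sum_le _ _).trans ?_
    have hab : ∀ a b, ‖J a b p * (conj (ν a p.1) * ν b p.2)‖ ≤
        M a b * B ^ 2 * ((1 / 2 : ℝ) ^ p.1 * (1 / 2 : ℝ) ^ p.2) := by
      intro a b
      rw [norm_mul, norm_mul, Complex.norm_conj]
      calc ‖J a b p‖ * (‖ν a p.1‖ * ‖ν b p.2‖)
          ≤ M a b / (ρ a ^ p.1 * ρ b ^ p.2) * ((B * κ ^ p.1) * (B * κ ^ p.2)) :=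
            mul_le_mul (hJ a b p) (mul_le_mul (hν a _) (hν b _) (norm_nonneg _)
              (by positivity)) (by positivity)
              (by have := hM0 a b; have := hρ0 a; have := hρ0 b; positivity)
        _ = M a b * B ^ 2 * ((κ ^ p.1 / ρ a ^ p.1) * (κ ^ p.2 / ρ b ^ p.2)) := by
            have := hρ0 a; have := hρ0 b
            field_simp
        _ ≤ M a b * B ^ 2 * ((1 / 2 : ℝ) ^ p.1 * (1 / 2 : ℝ) ^ p.2) :=
            mul_le_mul_of_nonneg_left (mul_le_mul (hκρ' a _) (hκρ' b _)
              (div_nonneg (pow_nonneg hκ.le _) (pow_nonneg (hρ0 b).le _))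
              (by positivity)) (by have := hM0 a b; positivity)
    calc ∑ a, ‖∑ b, J a b p * (conj (ν a p.1) * ν b p.2)‖
        ≤ ∑ a, ∑ b, M a b * B ^ 2 * ((1 / 2 : ℝ) ^ p.1 * (1 / 2 : ℝ) ^ p.2) :=
          Finset.sum_le_sum fun a _ => (norm_sum_le _ _).trans (Finset.sum_le_sum fun b _ => hab a b)
      _ = bound p := by
          simp only [hbound_def, Finset.sum_mul]
  have hbound_sum : Summable bound := by
    have hg : Summable fun j : ℕ => ‖(1 / 2 : ℝ) ^ j‖ := by
      simpa [norm_pow] using summable_geometric_two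
    have := (summable_mul_of_summable_norm hg hg).mul_left ((∑ a, ∑ b, M a b) * B ^ 2)
    exact this
  -- Tannery
  have hlim : Tendsto (fun n => ∑' p, f n p) atTop (𝓝 (∑' p, g p)) := by
    refine tendsto_tsum_of_dominated_convergence hbound_sum (fun p => ?_)
      (Eventually.of_forall fun n p => hterm (μ n) (hμB n) p)
    exact tendsto_finsetSum _ fun a _ => tendsto_finsetSum _ fun b _ =>
      ((Complex.continuous_conj.tendsto _ |>.comp (hμlim a p.1)).mul (hμlim b p.2)).const_mul _
  have hpos : ∀ n, 0 ≤ ∑' p, f n p := fun n => hreal (ε n) (hε n).1 (hε n).2 (γ n)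
  have hg_nonneg : 0 ≤ ∑' p, g p := ge_of_tendsto' hlim hpos
  -- the limit family is the (finitely supported) jet form
  have hg_supp : ∀ p ∉ range (N + 1) ×ˢ range (N + 1), g p = 0 := by
    intro p hp
    rw [Finset.mem_product, Finset.mem_range, Finset.mem_range, not_and_or, not_lt, not_lt] at hp
    simp only [hg_def, hμ₀_def]
    rcases hp with hp | hp
    · have : ¬ p.1 ≤ N := by omega
      simp [this]
    · have : ¬ p.2 ≤ N := by omega
      simp [this]
  have hg_eq : ∑' p, g p = ∑ p ∈ range (N + 1) ×ˢ range (N + 1),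
      ∑ a, ∑ b, J a b p * (conj (w a p.1) * w b p.2) := by
    rw [tsum_eq_sum hg_supp]
    refine Finset.sum_congr rfl fun p hp => ?_
    rw [Finset.mem_product, Finset.mem_range, Finset.mem_range] at hp
    simp only [hg_def, hμ₀_def, if_pos (Nat.le_of_lt_succ hp.1), if_pos (Nat.le_of_lt_succ hp.2)]
  rwa [hg_eq] at hg_nonneg

end Jet

/-! ### Glaser's lemma -/

section Glaser

variable {X : Type*}

/-- Finite sums of `HasSum`s over a double finite index. [folklore] -/
theorem hasSum_sum_sum {ι₁ ι₂ γ : Type*} [AddCommMonoid γ] [TopologicalSpace γ] [ContinuousAdd γ]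
    (s₁ : Finset ι₁) (s₂ : Finset ι₂) {f : ι₁ → ι₂ → ℕ × ℕ → γ} {a : ι₁ → ι₂ → γ}
    (h : ∀ i ∈ s₁, ∀ j ∈ s₂, HasSum (f i j) (a i j)) :
    HasSum (fun p => ∑ i ∈ s₁, ∑ j ∈ s₂, f i j p) (∑ i ∈ s₁, ∑ j ∈ s₂, a i j) :=
  hasSum_sum fun i hi => hasSum_sum fun j hj => h i hi j hj

/-- **Glaser's lemma: positive-definiteness propagates under analytic continuation**
(V. Glaser (1974), the positivity step of the Euclidean ⇒ Wightman equivalence: a kernel which is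
positive-semidefinite on a real environment and sesqui-holomorphic is positive-semidefinite on the
whole domain of holomorphy; here the one-variable form with parameters, from which the general
case follows by induction on the number of variables). Let `K` be a kernel on `X × ℂ` such that on
the open right half-plane `Π = {Re > 0}` one has `K ((u, s), (u', s')) = k u u' (conj s) s'` with
every `k u u'` admitting bounded double Taylor expansions on closed bidiscs in `Π × Π`
(`HasLocalTaylor₂`; e.g. `(s, t) ↦ W (a + s v + t v')` for a holomorphic `W`,
`hasLocalTaylor₂_comp_affine`). If `K` is positive-semidefinite on the real points `X × (0, ∞)`,
then `K` is positive-semidefinite on `X × Π`. Proof in the module docstring (Taylor expansion at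
the real centres `σ = |δ|²/Re δ`, jet positivity `jetForm_nonneg`, truncation). [cite: GlaserCMP1974, §2 (positivity condition in the causal domain)] -/
theorem isPosSemidefKernelOn_halfPlane_of_ofReal {K : X × ℂ → X × ℂ → ℂ}
    {k : X → X → ℂ → ℂ → ℂ}
    (hk : ∀ u u', HasLocalTaylor₂ (k u u') {z : ℂ | 0 < z.re} {z : ℂ | 0 < z.re})
    (hK : ∀ u u' (s s' : ℂ), 0 < s.re → 0 < s'.re → K (u, s) (u', s') = k u u' (conj s) s')
    (hpos : IsPosSemidefKernelOn K {p | 0 < p.2.re ∧ p.2.im = 0}) :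
    IsPosSemidefKernelOn K {p | 0 < p.2.re} := by
  intro m P hP c
  rcases Nat.eq_zero_or_pos m with rfl | hm
  · simp
  -- data
  set u : Fin m → X := fun a => (P a).1 with hu
  set δ : Fin m → ℂ := fun a => (P a).2 with hδ_def
  have hδ : ∀ a, 0 < (δ a).re := fun a => hP a
  have hδ0 : ∀ a, 0 < ‖δ a‖ := fun a =>
    norm_pos_iff.2 fun h => by have := hδ a; rw [h] at this; simp at this
  -- real centres and radii
  set σ : Fin m → ℝ := fun a => ‖δ a‖ ^ 2 / (δ a).re with hσ_def
  have hσ : ∀ a, 0 < σ a := fun a => div_pos (pow_pos (hδ0 a) 2) (hδ a)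
  have hdist : ∀ a, ‖δ a - σ a‖ < σ a := by
    intro a
    have hre : σ a * (δ a).re = ‖δ a‖ ^ 2 := by
      simp only [hσ_def]
      exact div_mul_cancel₀ _ (hδ a).ne'
    have hsq : ‖δ a - σ a‖ ^ 2 < σ a ^ 2 := by
      have h1 : ‖δ a - σ a‖ ^ 2 = ‖δ a‖ ^ 2 - 2 * (σ a * (δ a).re) + σ a ^ 2 := by
        rw [Complex.sq_norm, Complex.sq_norm, Complex.normSq_apply, Complex.normSq_apply]
        simp only [Complex.sub_re, Complex.sub_im, Complex.ofReal_re, Complex.ofReal_im, sub_zero]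
        ring
      rw [h1, hre]
      nlinarith [pow_pos (hδ0 a) 2]
    exact lt_of_pow_lt_pow_left₀ 2 (hσ a).le hsq
  set ρ : Fin m → ℝ := fun a => (‖δ a - σ a‖ + σ a) / 2 with hρ_def
  have hρ : ∀ a, ‖δ a - σ a‖ < ρ a ∧ ρ a < σ a ∧ 0 < ρ a := fun a => by
    have := hdist a
    have h0 : 0 ≤ ‖δ a - σ a‖ := norm_nonneg _
    refine ⟨?_, ?_, ?_⟩ <;> simp only [hρ_def] <;> linarith
  have hballP : ∀ a, closedBall ((σ a : ℝ) : ℂ) (ρ a) ⊆ {z : ℂ | 0 < z.re} := by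
    intro a z hz
    rw [mem_closedBall, dist_eq_norm] at hz
    have h1 : |(z - σ a).re| ≤ ‖z - (σ a : ℂ)‖ := Complex.abs_re_le_norm _
    simp only [Complex.sub_re, Complex.ofReal_re] at h1
    show 0 < z.re
    have := (hρ a).2.1
    linarith [neg_abs_le ((z.re - σ a)), abs_sub_comm z.re (σ a), le_abs_self (σ a - z.re)]
  -- Taylor data for every pair
  have hT := fun a b => hk (u a) (u b) (hρ a).2.2 (hρ b).2.2 (hballP a) (hballP b)
  choose J M hJ hsum using hT
  -- a common node scale `κ ≤ ρ_a / 2`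
  obtain ⟨a₀, -, ha₀⟩ := Finset.exists_min_image Finset.univ ρ
    (Finset.univ_nonempty_iff.2 ⟨⟨0, hm⟩⟩)
  set κ : ℝ := ρ a₀ / 2 with hκ_def
  have hκ : 0 < κ := by have := (hρ a₀).2.2; positivity
  have hκρ : ∀ a, 2 * κ ≤ ρ a := fun a => by
    have := ha₀ a (Finset.mem_univ a); simp only [hκ_def]; linarith
  -- the quadratic form as the sum of a double series
  set v : Fin m → ℕ → ℂ := fun a j => c a * (δ a - σ a) ^ j with hv_def
  set T : ℕ × ℕ → ℂ := fun p => ∑ a, ∑ b, J a b p * (conj (v a p.1) * v b p.2) with hT_def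
  have hmemc : ∀ a, conj (δ a) ∈ ball ((σ a : ℝ) : ℂ) (ρ a) := fun a => by
    rw [mem_ball, dist_eq_norm, ← Complex.conj_ofReal, ← map_sub, Complex.norm_conj]
    exact (hρ a).1
  have hmem : ∀ a, δ a ∈ ball ((σ a : ℝ) : ℂ) (ρ a) := fun a => by
    rw [mem_ball, dist_eq_norm]; exact (hρ a).1
  have hQ : HasSum T (∑ a, ∑ b, conj (c a) * c b * K (P a) (P b)) := by
    have h := hasSum_sum_sum Finset.univ Finset.univ (fun a _ b _ =>
      ((hsum a b (hmemc a) (hmem b)).mul_left (conj (c a) * c b)))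
    have hfun : (fun p : ℕ × ℕ => ∑ a, ∑ b, conj (c a) * c b *
        (J a b p * ((conj (δ a) - σ a) ^ p.1 * (δ b - σ b) ^ p.2))) = T := by
      funext p
      simp only [hT_def, hv_def, map_mul, map_pow, map_sub, Complex.conj_ofReal]
      refine Finset.sum_congr rfl fun a _ => Finset.sum_congr rfl fun b _ => ?_
      ring
    have hval : ∑ a, ∑ b, conj (c a) * c b * k (u a) (u b) (conj (δ a)) (δ b) =
        ∑ a, ∑ b, conj (c a) * c b * K (P a) (P b) := by
      refine Finset.sum_congr rfl fun a _ => Finset.sum_congr rfl fun b _ => ?_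
      rw [hK (u a) (u b) (δ a) (δ b) (hδ a) (hδ b)]
    rw [hfun, hval] at h
    exact h
  -- truncations converge to the quadratic form
  set R : ℕ → Finset (ℕ × ℕ) := fun N => range (N + 1) ×ˢ range (N + 1) with hR_def
  have hRmono : Monotone R := fun N N' h => Finset.product_subset_product
    (range_subset_range.2 (by omega)) (range_subset_range.2 (by omega))
  have hRcover : ∀ p : ℕ × ℕ, ∃ N, p ∈ R N := fun p =>
    ⟨max p.1 p.2, by simp only [hR_def, Finset.mem_product, Finset.mem_range]; omega⟩
  have htrunc : Tendsto (fun N => ∑ p ∈ R N, T p) atTop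
      (𝓝 (∑ a, ∑ b, conj (c a) * c b * K (P a) (P b))) :=
    hQ.comp (tendsto_atTop_finset_of_monotone hRmono hRcover)
  refine ge_of_tendsto' htrunc fun N => ?_
  -- jet positivity: nodes and the real quadratic forms
  set ξ : Fin (N + 1) → ℝ := fun i => κ * (((i : ℕ) : ℝ) + 1) / ((N : ℝ) + 1) with hξ_def
  have hξκ : ∀ i, 0 < ξ i ∧ ξ i ≤ κ := fun i => by
    refine ⟨by positivity, ?_⟩
    rw [hξ_def, div_le_iff₀ (by positivity)]
    have : ((i : ℕ) : ℝ) + 1 ≤ (N : ℝ) + 1 := by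
      have := i.2; exact_mod_cast this
    nlinarith
  have hξinj : Function.Injective ξ := by
    intro i i' h
    simp only [hξ_def] at h
    rw [div_left_inj' (by positivity), mul_right_inj' hκ.ne'] at h
    exact Fin.ext (by exact_mod_cast (add_right_cancel h : ((i : ℕ) : ℝ) = (i' : ℕ)))
  refine jetForm_nonneg J M ρ hκ hκρ hJ hξinj hξκ (fun ε' hε' hε'1 Γ => ?_) v
  -- positivity of `K` at the real points `(u_a, σ_a + ε' ξ_i)`
  set pt : Fin m → Fin (N + 1) → ℂ := fun a i => ((σ a + ε' * ξ i : ℝ) : ℂ) with hpt_def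
  have hpt_mem : ∀ a i, pt a i ∈ ball ((σ a : ℝ) : ℂ) (ρ a) := fun a i => by
    rw [mem_ball, dist_eq_norm, hpt_def]
    push_cast
    rw [add_sub_cancel_left, norm_mul, Complex.norm_real, Complex.norm_real,
      Real.norm_of_nonneg hε'.le, Real.norm_of_nonneg (hξκ i).1.le]
    calc ε' * ξ i ≤ 1 * κ := mul_le_mul hε'1 (hξκ i).2 (hξκ i).1.le zero_le_one
      _ < ρ a := by linarith [hκρ a, hκ]
  have hpt_re : ∀ a i, 0 < (pt a i).re ∧ (pt a i).im = 0 := fun a i => by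
    simp only [hpt_def, Complex.ofReal_re, Complex.ofReal_im]
    exact ⟨by have := hσ a; have := (hξκ i).1; positivity, trivial⟩
  have hpd := hpos.sum_nonneg (ι := Fin m × Fin (N + 1)) (fun q => (u q.1, pt q.1 q.2))
    (fun q => hpt_re q.1 q.2) (fun q => Γ q.1 q.2)
  -- the value of `K` at the real points is the sum of the real Taylor series
  have hnode : ∀ a i, pt a i - (σ a : ℂ) = ((ε' * ξ i : ℝ) : ℂ) := fun a i => by
    simp only [hpt_def]; push_cast; ring
  have hKpt : ∀ a i b i', HasSum (fun p : ℕ × ℕ => J a b p *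
      (((ε' * ξ i : ℝ) : ℂ) ^ p.1 * ((ε' * ξ i' : ℝ) : ℂ) ^ p.2))
      (K (u a, pt a i) (u b, pt b i')) := by
    intro a i b i'
    have h := hsum a b (s := pt a i) (by exact hpt_mem a i) (hpt_mem b i')
    rw [hnode, hnode] at h
    rw [hK _ _ _ _ (hpt_re a i).1 (hpt_re b i').1]
    have hc : conj (pt a i) = pt a i := by rw [hpt_def, Complex.conj_ofReal]
    rwa [hc]
  have hS := hasSum_sum_sum Finset.univ Finset.univ
    (fun (q : Fin m × Fin (N + 1)) _ (q' : Fin m × Fin (N + 1)) _ =>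
      (hKpt q.1 q.2 q'.1 q'.2).mul_left (conj (Γ q.1 q.2) * Γ q'.1 q'.2))
  -- regroup the finite sums into moments
  have hfun : (fun p : ℕ × ℕ => ∑ q : Fin m × Fin (N + 1), ∑ q' : Fin m × Fin (N + 1),
      conj (Γ q.1 q.2) * Γ q'.1 q'.2 * (J q.1 q'.1 p *
        (((ε' * ξ q.2 : ℝ) : ℂ) ^ p.1 * ((ε' * ξ q'.2 : ℝ) : ℂ) ^ p.2))) =
      fun p => ∑ a, ∑ b, J a b p *
        (conj (∑ i, Γ a i * ((ε' * ξ i : ℝ) : ℂ) ^ p.1) * ∑ i, Γ b i * ((ε' * ξ i : ℝ) : ℂ) ^ p.2) := by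
    funext p
    rw [Fintype.sum_prod_type]
    refine Finset.sum_congr rfl fun a _ => ?_
    rw [Finset.sum_comm]  -- ∑ i, ∑ q' = ∑ q', ∑ i  (q' over the product)
    rw [Fintype.sum_prod_type]
    refine Finset.sum_congr rfl fun b _ => ?_
    rw [map_sum, Finset.sum_mul, Finset.mul_sum]
    rw [Finset.sum_comm]
    refine Finset.sum_congr rfl fun i _ => ?_
    rw [Finset.mul_sum, Finset.mul_sum]
    refine Finset.sum_congr rfl fun i' _ => ?_
    dsimp only
    simp only [map_mul, map_pow, Complex.conj_ofReal]
    ring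
  rw [hfun] at hS
  rw [hS.tsum_eq]
  exact hpd

end Glaser

end Literature.Analysis.Complex
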